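import Summits.KontsevichZagierPeriods.KontsevichZagierPeriods.Theorems.LinRedNormalFormArrangementNormalFormStubRebaseSimplePosManyCorner

/-!
# Stub `stub_rebaseSimplePosMany`, part `rebaseSimplePosMany_product` (crux `ArrangementNormalForm`, line `janus-bands`) — `Fibre`

Processing ONE fibre `i` of a product representation over a base of dimension `B + 1` with `K`
fibres, the other fibres riding along as spectators, and the FIBRE-BY-FIBRE INDUCTION (the
`B`-generic port of `RebaseZero`'s parts `Fibre` and `Product`):
* `RebaseMany.good_letterZero` — letter `0`, transverse bounds `u < v`: cut the base cell by the
  signs of `u` and `v` (rule 1a): above the letter (`RebaseMany.good_above`, part `Above`),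
  crossing (cut the fibre at the letter level `0`, both halves terminal), below (reflection
  `tᵢ ↦ −tᵢ`, then `good_above`);
* `RebaseMany.good_lettered` — any letter `c`: a bound parallel in `y` to the letter is terminal;
  otherwise record the row `v − u > 0`, shear the letter to `0` (rule 2) and apply `good_letterZero`;
* `RebaseMany.good_fibre` — letter-free fibres are terminal;
  all three given the continuation hypothesis `HPc` and the residual continuation hypothesis `HRc`;
* `RebaseMany.HRes` — the RESIDUAL ORACLE (every product representation one of whose fibres is
  residual, with letter `0`, is good given the full continuation hypothesis `HP` for that fibre)
  and the induction `RebaseMany.good_of_card_le` / `good_isProd_of_oracle` on the number of fibres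
  not yet in format, whose base case is the packaging lemma `good_of_allFmt`;
* the TAME variant without oracle: a fibre is tame if it is letter-free, has a bound parallel to
  its letter, or is THICK (`v − u ≥ c₀ > 0` on the base cell); tameness is inherited by sub-cells,
  so the induction with the restricted continuation hypothesis `HPc` closes:
  `RebaseMany.good_fibre_tame`, `RebaseMany.good_isProd_tame` (every product representation all of
  whose fibres are tame is good — unconditionally).
Registered: `rebaseSimplePosMany_isProd_tame`.

References: M. Kontsevich, D. Zagier, *Periods* (2001), §1.2.
-/

noncomputable section

open Set MeasureTheory MvPolynomial
open Literature.NumberTheory.Transcendental Literature.ModelTheory.ExponentialFields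

namespace Summit.KontsevichZagierPeriods.ArrangementNormalForm.JanusBands

namespace RebaseMany

open SeparatePos RebasePos

variable {B K : ℕ}

section Fibre

variable {s : KZ.IntegralRep (B + 1 + K)} {m' : ℕ} {M : Fin m' → Cf B} {U V : Fin K → Cf B}
  {T : BData B} {p : MvPolynomial (Fin B) ℚ} {a : Fin K → Option (Cf B)}

/-- The reflected letter `0` is `0`. [folklore] -/
theorem map_neg_some_zero : (some (0 : Cf B)).map Neg.neg = some 0 := by simp

/-- **Letter `0`, transverse bounds: dissection by the signs of the bounds** (rule 1a): above the
letter (`good_above`), crossing (cut at the level `0`, both halves terminal), below (reflection,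
then `good_above`). -/
theorem good_letterZero (h : IsProd s M U V T p a) (i : Fin K) (ha : a i = some 0)
    (hP : HPc T i M U V a) (hR : HRc T i M U V a)
    (hu : (U i).1 (Fin.last B) ≠ 0) (hv : (V i).1 (Fin.last B) ≠ 0)
    (huv : ∀ z ∈ cell K M, affF B K (U i) z < affF B K (V i) z) : Good B K (KZ.of s) := by
  refine rowSplit h (U i) (ne_zero_of_last hu) (fun s₁ h₁ => ?_) (fun s₂ h₂ => ?_)
  · -- above the letter
    exact good_above h₁ i ha (hP.mono (cell_snoc_subset M _)) ((hR.mono (cell_snoc_subset M _)).toHRl ha _)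
      hu hv fun z hz => by
        obtain ⟨hz', hu0⟩ := (mem_cell_snoc _ _ z).1 hz
        exact ⟨hu0, huv z hz'⟩
  · have hsub₂ : cell K (Fin.snoc M (-U i) : Fin (m' + 1) → Cf B) ⊆ cell K M := cell_snoc_subset M _
    refine rowSplit h₂ (V i) (ne_zero_of_last hv) (fun s₃ h₃ => ?_) (fun s₄ h₄ => ?_)
    · -- crossing the letter: split at the level `0`
      refine good_levelCut h₃ i ((hP.mono hsub₂).mono (cell_snoc_subset _ _)) 0
        (yfree_of_letter_zero i ha 0 rfl) fun z hz => ?_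
      obtain ⟨hz', hv0⟩ := (mem_cell_snoc _ _ z).1 hz
      obtain ⟨-, hu0⟩ := (mem_cell_snoc _ _ z).1 hz'
      rw [affF_neg] at hu0
      rw [affF_zero]
      exact ⟨by linarith, hv0.le⟩
    · -- below the letter: reflect
      obtain ⟨s', h', hrel⟩ := reflect h₄ i
      have hsub : cell K (Fin.snoc (Fin.snoc M (-U i) : Fin (m' + 1) → Cf B) (-V i) : Fin (m' + 1 + 1) → Cf B) ⊆
          cell K M := (cell_snoc_subset _ _).trans hsub₂
      have ha' : Function.update a i ((a i).map Neg.neg) i = some 0 := by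
        rw [Function.update_self, ha, map_neg_some_zero]
      refine good_of_sub_mem hrel (good_above h' i ha' ((hP.mono hsub).transfer (same_update i U V a _ _ _))
        (((hR.mono hsub).transfer (same_update i U V a _ _ _)).toHRl ha' _) ?_ ?_ fun z hz => ?_)
      · rw [Function.update_self, neg_fst_last]; exact neg_ne_zero.2 hv
      · rw [Function.update_self, neg_fst_last]; exact neg_ne_zero.2 hu
      · obtain ⟨hz', hv0⟩ := (mem_cell_snoc _ _ z).1 hz
        obtain ⟨hz'', -⟩ := (mem_cell_snoc _ _ z).1 hz'
        rw [affF_neg] at hv0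
        rw [Function.update_self, Function.update_self, affF_neg, affF_neg]
        exact ⟨by linarith, by linarith [huv z hz'']⟩

/-- **A lettered fibre is good** (given `HPc` and `HRc`): a bound parallel in `y` to the letter
is terminal; otherwise record the row `v − u > 0`, shear the letter to `0` and dissect. -/
theorem good_lettered (h : IsProd s M U V T p a) (i : Fin K) (c : Cf B) (ha : a i = some c)
    (hP : HPc T i M U V a) (hR : HRc T i M U V a) : Good B K (KZ.of s) := by
  by_cases hU : (U i).1 (Fin.last B) = c.1 (Fin.last B)
  · exact good_terminal h i hP fun c' hc' => Or.inl (by rw [ha] at hc'; cases hc'; exact hU)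
  by_cases hV : (V i).1 (Fin.last B) = c.1 (Fin.last B)
  · exact good_terminal h i hP fun c' hc' => Or.inr (by rw [ha] at hc'; cases hc'; exact hV)
  have h' := h.addRow i
  have hsub : cell K (Fin.snoc M (V i - U i) : Fin (m' + 1) → Cf B) ⊆ cell K M := cell_snoc_subset M _
  obtain ⟨s', hs', hrel⟩ := shear h' i c ha
  refine good_of_sub_mem hrel (good_letterZero hs' i (by rw [Function.update_self])
    ((hP.mono hsub).transfer (same_update i U V a _ _ _))
    ((hR.mono hsub).transfer (same_update i U V a _ _ _)) ?_ ?_ fun z hz => ?_)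
  · rw [Function.update_self, pullC_shear_fst_last]; exact sub_ne_zero.2 hU
  · rw [Function.update_self, pullC_shear_fst_last]; exact sub_ne_zero.2 hV
  · rw [Function.update_self, Function.update_self, affF_pullC_shear, affF_pullC_shear]
    have h2 := ((mem_cell_snoc M _ z).1 hz).2
    rw [affF_sub] at h2
    linarith

/-- **Every fibre can be processed** (given `HPc` and `HRc`): a letter-free fibre is terminal,
a lettered one is `good_lettered`. -/
theorem good_fibre (h : IsProd s M U V T p a) (i : Fin K) (hP : HPc T i M U V a) (hR : HRc T i M U V a) :
    Good B K (KZ.of s) := by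
  rcases ha : a i with _ | c
  · exact good_terminal h i hP fun c hc => by rw [ha] at hc; exact absurd hc (Option.some_ne_none c).symm
  · exact good_lettered h i c ha hP hR

/-! ### Tame fibres (no oracle) -/

/-- A fibre datum is TAME over the base cell `cell K M`: it is letter-free or has a bound parallel
in `y` to its letter (terminal), or it is THICK (`u + c₀ ≤ v` for a constant `c₀ > 0`).
[folklore] -/
def Tame (K : ℕ) {m' : ℕ} (M : Fin m' → Cf B) (a : Option (Cf B)) (u v : Cf B) : Prop :=
  (∀ c, a = some c → u.1 (Fin.last B) = c.1 (Fin.last B) ∨ v.1 (Fin.last B) = c.1 (Fin.last B)) ∨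
    ∃ c₀ : ℝ, 0 < c₀ ∧ ∀ z ∈ cell K M, affF B K u z + c₀ ≤ affF B K v z

/-- Tameness is inherited by smaller base cells. [folklore] -/
theorem Tame.mono {m' m'' : ℕ} {M : Fin m' → Cf B} {M' : Fin m'' → Cf B} {a : Option (Cf B)}
    {u v : Cf B} (h : Tame K M a u v) (hsub : cell K M' ⊆ cell K M) : Tame K M' a u v := by
  rcases h with h | ⟨c₀, hc₀, h⟩
  · exact Or.inl h
  · exact Or.inr ⟨c₀, hc₀, fun z hz => h z (hsub hz)⟩

/-- **Letter `0`, transverse bounds, THICK: dissection by the signs of the bounds**, every piece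
closed by `good_thickBand` / a level cut / reflection + `good_thickBand`. -/
theorem good_letterZero_thick (h : IsProd s M U V T p a) (i : Fin K) (ha : a i = some 0)
    (hP : HPc T i M U V a) (hu : (U i).1 (Fin.last B) ≠ 0) (hv : (V i).1 (Fin.last B) ≠ 0)
    (c₀ : ℝ) (hc₀ : 0 < c₀) (hth : ∀ z ∈ cell K M, affF B K (U i) z + c₀ ≤ affF B K (V i) z) :
    Good B K (KZ.of s) := by
  refine rowSplit h (U i) (ne_zero_of_last hu) (fun s₁ h₁ => ?_) (fun s₂ h₂ => ?_)
  · exact good_thickBand h₁ i ha (hP.mono (cell_snoc_subset M _)) c₀ hc₀ fun z hz => by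
      obtain ⟨hz', hu0⟩ := (mem_cell_snoc _ _ z).1 hz
      exact ⟨hu0, hth z hz'⟩
  · have hsub₂ : cell K (Fin.snoc M (-U i) : Fin (m' + 1) → Cf B) ⊆ cell K M := cell_snoc_subset M _
    refine rowSplit h₂ (V i) (ne_zero_of_last hv) (fun s₃ h₃ => ?_) (fun s₄ h₄ => ?_)
    · refine good_levelCut h₃ i ((hP.mono hsub₂).mono (cell_snoc_subset _ _)) 0
        (yfree_of_letter_zero i ha 0 rfl) fun z hz => ?_
      obtain ⟨hz', hv0⟩ := (mem_cell_snoc _ _ z).1 hz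
      obtain ⟨-, hu0⟩ := (mem_cell_snoc _ _ z).1 hz'
      rw [affF_neg] at hu0
      rw [affF_zero]
      exact ⟨by linarith, hv0.le⟩
    · obtain ⟨s', h', hrel⟩ := reflect h₄ i
      have hsub : cell K (Fin.snoc (Fin.snoc M (-U i) : Fin (m' + 1) → Cf B) (-V i) : Fin (m' + 1 + 1) → Cf B) ⊆
          cell K M := (cell_snoc_subset _ _).trans hsub₂
      refine good_of_sub_mem hrel (good_thickBand h' i ?_ ((hP.mono hsub).transfer (same_update i U V a _ _ _))
        c₀ hc₀ fun z hz => ?_)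
      · rw [Function.update_self, ha, map_neg_some_zero]
      · obtain ⟨hz', hv0⟩ := (mem_cell_snoc _ _ z).1 hz
        obtain ⟨hz'', -⟩ := (mem_cell_snoc _ _ z).1 hz'
        rw [affF_neg] at hv0
        rw [Function.update_self, Function.update_self, affF_neg, affF_neg]
        exact ⟨by linarith, by linarith [hth z hz'']⟩

/-- **A tame fibre is good**, given the restricted continuation hypothesis only. -/
theorem good_fibre_tame (h : IsProd s M U V T p a) (i : Fin K) (hP : HPc T i M U V a)
    (ht : Tame K M (a i) (U i) (V i)) : Good B K (KZ.of s) := by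
  rcases ht with ht | ⟨c₀, hc₀, hth⟩
  · exact good_terminal h i hP ht
  rcases ha : a i with _ | c
  · exact good_terminal h i hP fun c hc => by rw [ha] at hc; exact absurd hc (Option.some_ne_none c).symm
  by_cases hU : (U i).1 (Fin.last B) = c.1 (Fin.last B)
  · exact good_terminal h i hP fun c' hc' => Or.inl (by rw [ha] at hc'; cases hc'; exact hU)
  by_cases hV : (V i).1 (Fin.last B) = c.1 (Fin.last B)
  · exact good_terminal h i hP fun c' hc' => Or.inr (by rw [ha] at hc'; cases hc'; exact hV)
  obtain ⟨s', hs', hrel⟩ := shear h i c ha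
  refine good_of_sub_mem hrel (good_letterZero_thick hs' i (by rw [Function.update_self])
    (hP.transfer (same_update i U V a _ _ _)) ?_ ?_ c₀ hc₀ fun z hz => ?_)
  · rw [Function.update_self, pullC_shear_fst_last]; exact sub_ne_zero.2 hU
  · rw [Function.update_self, pullC_shear_fst_last]; exact sub_ne_zero.2 hV
  · rw [Function.update_self, Function.update_self, affF_pullC_shear, affF_pullC_shear]
    linarith [hth z hz]

end Fibre

/-! ### The inductions over the fibres -/

/-- The RESIDUAL ORACLE for the base-factor data `T`: every product representation one of whose
fibres `i` has letter `0` and is residual over the base cell is good, given the full continuation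
hypothesis for `i` (all product representations with fibre `i` in format and the same spectators
are good). This is the open analytic core of the rebase of product fibres over a base of
dimension `≥ 2` (thin parallel bands and corner bands in the presence of spectators). [folklore] -/
def HRes (K : ℕ) (T : BData B) : Prop :=
  ∀ (m' : ℕ) (s : KZ.IntegralRep (B + 1 + K)) (M : Fin m' → Cf B) (U V : Fin K → Cf B)
    (p : MvPolynomial (Fin B) ℚ) (a : Fin K → Option (Cf B)) (i : Fin K), IsProd s M U V T p a →
    HP T i U V a → a i = some 0 → IsResidual K M (U i) (V i) → Good B K (KZ.of s)

/-- **The fibre-by-fibre induction from the residual oracle.** A product representation at most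
`n` of whose fibres are not in format is good: process one unformatted fibre (`good_fibre`); the
continuation hypothesis is the induction hypothesis, the residual continuation hypothesis is the
oracle fed with the induction hypothesis. [folklore] -/
theorem good_of_card_le (T : BData B) (hO : HRes K T) (n : ℕ) : ∀ {m' : ℕ} (s : KZ.IntegralRep (B + 1 + K))
    (M : Fin m' → Cf B) (U V : Fin K → Cf B) (p : MvPolynomial (Fin B) ℚ) (a : Fin K → Option (Cf B)),
    IsProd s M U V T p a → ∀ S : Finset (Fin K), S.card ≤ n →
    (∀ j, j ∉ S → InFmt (a j) (U j) (V j)) → Good B K (KZ.of s) := by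
  induction n with
  | zero =>
    intro m' s M U V p a h S hS hf
    have hS' : S = ∅ := Finset.card_eq_zero.1 (Nat.le_zero.1 hS)
    exact good_of_allFmt h fun j => hf j (by simp [hS'])
  | succ n ih =>
    intro m' s M U V p a h S hS hf
    by_cases hall : ∀ j ∈ S, InFmt (a j) (U j) (V j)
    · refine good_of_allFmt h fun j => ?_
      by_cases hj : j ∈ S
      · exact hall j hj
      · exact hf j hj
    push Not at hall
    obtain ⟨i, hi, -⟩ := hall
    have hP : HP T i U V a := fun m'' s' M' U' V' p' a' h' hfi hs =>
      ih s' M' U' V' p' a' h' (S.erase i) (by rw [Finset.card_erase_of_mem hi]; omega) fun j hj => by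
        by_cases hji : j = i
        · subst hji; exact hfi
        · obtain ⟨h1, h2, h3⟩ := hs j hji
          rw [h1, h2, h3]
          exact hf j fun hjS => hj (Finset.mem_erase.2 ⟨hji, hjS⟩)
    have hR : HRc T i M U V a := fun m'' s' M' U' V' p' a' h' _ ha' hres hs =>
      hO m'' s' M' U' V' p' a' i h' (hP.transfer hs) ha' hres
    exact good_fibre h i (hP.toHPc M) hR

/-- **Every product representation is good, given the residual oracle.** [folklore] -/
theorem good_isProd_of_oracle {s : KZ.IntegralRep (B + 1 + K)} {m' : ℕ} {M : Fin m' → Cf B}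
    {U V : Fin K → Cf B} {T : BData B} {p : MvPolynomial (Fin B) ℚ} {a : Fin K → Option (Cf B)}
    (hO : HRes K T) (h : IsProd s M U V T p a) : Good B K (KZ.of s) :=
  good_of_card_le T hO K s M U V p a h Finset.univ (by simp) fun j hj => absurd (Finset.mem_univ j) hj

/-- **The fibre-by-fibre induction for tame fibres** (no oracle): the invariant "every unformatted
fibre is tame over the current base cell" is inherited by sub-cells, and all moves keep or shrink
the base cell (`HPc`). [folklore] -/
theorem good_of_card_le_tame (T : BData B) (n : ℕ) : ∀ {m' : ℕ} (s : KZ.IntegralRep (B + 1 + K))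
    (M : Fin m' → Cf B) (U V : Fin K → Cf B) (p : MvPolynomial (Fin B) ℚ) (a : Fin K → Option (Cf B)),
    IsProd s M U V T p a → ∀ S : Finset (Fin K), S.card ≤ n →
    (∀ j, j ∉ S → InFmt (a j) (U j) (V j)) → (∀ j, j ∈ S → Tame K M (a j) (U j) (V j)) →
    Good B K (KZ.of s) := by
  induction n with
  | zero =>
    intro m' s M U V p a h S hS hf _
    have hS' : S = ∅ := Finset.card_eq_zero.1 (Nat.le_zero.1 hS)
    exact good_of_allFmt h fun j => hf j (by simp [hS'])
  | succ n ih =>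
    intro m' s M U V p a h S hS hf ht
    by_cases hall : ∀ j ∈ S, InFmt (a j) (U j) (V j)
    · refine good_of_allFmt h fun j => ?_
      by_cases hj : j ∈ S
      · exact hall j hj
      · exact hf j hj
    push Not at hall
    obtain ⟨i, hi, -⟩ := hall
    have hP : HPc T i M U V a := fun m'' s' M' U' V' p' a' h' hM' hfi hs =>
      ih s' M' U' V' p' a' h' (S.erase i) (by rw [Finset.card_erase_of_mem hi]; omega) (fun j hj => by
        by_cases hji : j = i
        · subst hji; exact hfi
        · obtain ⟨h1, h2, h3⟩ := hs j hji
          rw [h1, h2, h3]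
          exact hf j fun hjS => hj (Finset.mem_erase.2 ⟨hji, hjS⟩)) fun j hj => by
        obtain ⟨hji, hjS⟩ := Finset.mem_erase.1 hj
        obtain ⟨h1, h2, h3⟩ := hs j hji
        rw [h1, h2, h3]
        exact (ht j hjS).mono hM'
    exact good_fibre_tame h i hP (ht i hi)

/-- **Every product representation all of whose fibres are tame is good** (unconditionally).
[folklore] -/
theorem good_isProd_tame {s : KZ.IntegralRep (B + 1 + K)} {m' : ℕ} {M : Fin m' → Cf B}
    {U V : Fin K → Cf B} {T : BData B} {p : MvPolynomial (Fin B) ℚ} {a : Fin K → Option (Cf B)}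
    (h : IsProd s M U V T p a) (ht : ∀ j, Tame K M (a j) (U j) (V j)) : Good B K (KZ.of s) :=
  good_of_card_le_tame T K s M U V p a h Finset.univ (by simp) (fun j hj => absurd (Finset.mem_univ j) hj)
    fun j _ => ht j

end RebaseMany

/-- Registered support goal of this file: a product representation over a base of dimension
`B + 1` all of whose fibres are tame (letter-free, a bound parallel in `y` to the letter, or thick
over the base cell) is congruent modulo `KZ.relations` to the subgroup generated by the literal
rebased class `GG B 2 K` (`RebaseMany.good_isProd_tame`, unconditional). -/
theorem rebaseSimplePosMany_isProd_tame (B K m' : ℕ) (s : KZ.IntegralRep (B + 1 + K)) (M : Fin m' → (Fin (B + 1) → ℚ) × ℚ) (U V : Fin K → (Fin (B + 1) → ℚ) × ℚ) (T : RebaseMany.BData B) (p : MvPolynomial (Fin B) ℚ) (a : Fin K → Option ((Fin (B + 1) → ℚ) × ℚ)) (h : RebaseMany.IsProd s M U V T p a) (ht : ∀ j, RebaseMany.Tame K M (a j) (U j) (V j)) : ∃ c ∈ AddSubgroup.closure (SeparatePos.GGset B 2 K), KZ.of s - c ∈ KZ.relations :=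
  RebaseMany.good_isProd_tame h ht

end Summit.KontsevichZagierPeriods.ArrangementNormalForm.JanusBands
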